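import Mathlib

/-!
# Norm-form ("unitary circle") pencils and the stub `stub_tangencySets`
(crux `LevelOneGL2Designs`, stmt-MatrixMultiplication-14080) — wall-breaker axis 10/12,
*Hermitian unital constructions*, generation 1, part I: construction, level counts, reduction

The stub asks for strong representative systems (SRS) of `AG(2,p)` in dot-product normal form —
`S ⊆ 𝔽_p² × 𝔽_p²` with `f.1 ⬝ᵥ f'.2 = 1 ↔ f = f'` — of size `c·p^{3/2}` for unboundedly many
PRIMES `p`.  Over a field of square order the Hermitian unital does it (generation 0 of this axis,
`…StubTangencySetsHermitian`: the isotropic points of a unitary polarity with their tangents).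
Over the prime field the unitary structure that survives is the norm form of `𝔽_{p²}/𝔽_p`,
`Q(x,y) = x² − d y²` (`d` a non-square), its norm-one torus `U₁` of order `p + 1`, and the
`U₁`-orbits — the concentric circles `C_r = {Q = r}` of the Möbius plane.  This file settles what
circle pencils (and, for `d` a square, hyperbola pencils) give, for EVERY `d ≠ 0` at once:

* `polar_sq_sub_norm_mul_norm` — the one identity behind everything: `B(v,v')² − Q(v)Q(v') =
  d·(v × v')²` for the polar form `B`;
* `normPencil_srs` (**construction**) — if `R ⊆ 𝔽_pˣ` and `d·r(r − r')` is a non-square for all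
  `r ≠ r'` in `R` (a *norm-clique*), the points of `X_R = {v : Q v ∈ R}` with their level tangents
  `{w : B(w,v) = Q v}` form an SRS in the stub's format of size EXACTLY `|X_R|` — no flag is lost
  at the origin (every tangent `B(·,v) = r ≠ 0` avoids it), unlike the parabola pencils;
* `card_level_bounds`, `card_pencil_bounds` — every non-zero level has between `p − 1` and `p + 1`
  points (`p + 1` for circles: `card_circle` in part II), so `|R|(p−1) ≤ |X_R| ≤ |R|(p+1)`
  (equinumerosity of levels by the multiplicativity `norm_mulMap`, solubility of `Q = c` by
  Mathlib's `FiniteField.exists_root_sum_quadratic`, and `1 ≤ |{Q = 0}| ≤ 2p − 1`);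
* `stub_tangencySets_of_normCliques` (**residual, stub shape**) — norm-cliques of size `≥ c√p`
  for unboundedly many primes give `stub_tangencySets` verbatim with constant `c/2`.

Part II (`…TangencyNormPencilRigidity`) proves the converse (a union of `≥ 2` levels is a tangency
set ONLY under the norm-clique condition — it has no tangents but the level tangents), and the
ceiling: a norm-clique has `|R|² ≤ p + 1` (for `p ≡ 1 (mod 4)` it is a Paley clique or coclique
inside one residue class; for `p ≡ 3 (mod 4)` it has at most two elements), so the whole
architecture carries at most `(p+1)^{3/2}` flags and reaches the stub's `c·p^{3/2}` iff Paley
cliques of size `c√p` exist along primes `p ≡ 1 (mod 4)` — the square-root barrier already met by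
the parabola pencils (`…TangencyParabolaLift`, `…TangencyConics`, `…StubTangencySetsPaleyLift`).
So the prime-field shadow of the unitary construction is a third road to the same barrier, and is
EMPTY for half of the primes.  Elementary; Mathlib only; no new definitions.
-/

set_option linter.dupNamespace false

namespace Summit.MatrixMultiplication.MatrixMultiplication.Theorems.LevelOneGL2Designs.NormPencil

open Finset Matrix Polynomial

/-- **Polar identity of a binary norm form.**  For `Q(a,b) = a² − d b²` with polar form
`B((a,b),(a',b')) = aa' − d bb'`: `B² − Q·Q' = d·(ab' − a'b)²`. [elementary] -/
theorem polar_sq_sub_norm_mul_norm {K : Type*} [CommRing K] (d a b a' b' : K) :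
    (a * a' - d * (b * b')) ^ 2 - (a ^ 2 - d * b ^ 2) * (a' ^ 2 - d * b' ^ 2) =
      d * (a * b' - a' * b) ^ 2 := by
  ring

/-- **Multiplicativity of a binary norm form** (Brahmagupta's identity): the "multiplication by
`(s,t)`" map `(a,b) ↦ (sa + d tb, sb + ta)` multiplies `Q = x² − d y²` by `Q(s,t)`. [elementary] -/
theorem norm_mulMap {K : Type*} [CommRing K] (d s t a b : K) :
    (s * a + d * (t * b)) ^ 2 - d * (s * b + t * a) ^ 2 =
      (s ^ 2 - d * t ^ 2) * (a ^ 2 - d * b ^ 2) := by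
  ring

variable {p : ℕ} [Fact p.Prime]

/-- Dot product of a point `w` with the normal vector `(a/r, -db/r)` of the line
`a x − d b y = r` (the tangent of the level curve `x² − d y² = r` at `(a,b)`). [elementary] -/
theorem dotProduct_tangentNormal (d r a b : ZMod p) (w : Fin 2 → ZMod p) :
    w ⬝ᵥ (r⁻¹ • ![a, -(d * b)]) = r⁻¹ * (w 0 * a - d * (w 1 * b)) := by
  simp [dotProduct, Fin.sum_univ_two, smul_eq_mul]
  ring

/-! ## The construction: norm-form pencils with a non-square condition are SRS -/

/-- **Norm-form pencils are strong representative systems (construction).**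
Let `d ≠ 0` and `R ⊆ 𝔽_p ∖ {0}` be such that `d·r·(r − r')` is a NON-square for all `r ≠ r'` in
`R`.  Attach to every point `v = (a,b)` of a level curve `C_r : x² − d y² = r`, `r ∈ R`, the
tangent line `a x − d b y = r` of `C_r` at `v`, with normal vector `n_v = (a/r, −db/r)` (it avoids
the origin).  Then `v ⬝ᵥ n_{v'} = 1 ↔ v = v'` for all such flags, and there are exactly
`|{v : Q v ∈ R}|` of them.  Proof: if `v ∈ C_r` lies on the tangent at `v' ∈ C_{r'}` then
`B(v,v') = r'` and the polar identity gives `d·r'(r' − r) = (d(ab' − a'b))²`, a square, so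
`r = r'`; then `ab' = a'b`, whence `r·v' = r·v` coordinatewise and `v = v'`.
For `d` a non-square the `C_r` are `|R|` concentric circles of the Möbius plane of `𝔽_{p²}/𝔽_p`
(orbits of the norm-one torus `U₁`, `p + 1` points each): the prime-field shadow of the
Hermitian/unitary construction.  For `d` a square they are hyperbolas (`p − 1` points each).
[elementary] -/
theorem normPencil_srs (d : ZMod p) (hd : d ≠ 0) (R : Finset (ZMod p)) (hR0 : (0 : ZMod p) ∉ R)
    (hR : ∀ r ∈ R, ∀ r' ∈ R, r ≠ r' → ¬ IsSquare (d * (r * (r - r')))) :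
    ∃ S : Finset ((Fin 2 → ZMod p) × (Fin 2 → ZMod p)),
      S.card = (univ.filter fun v : Fin 2 → ZMod p => v 0 ^ 2 - d * v 1 ^ 2 ∈ R).card ∧
      ∀ f ∈ S, ∀ f' ∈ S, (f.1 ⬝ᵥ f'.2 = 1 ↔ f = f') := by
  classical
  set X := univ.filter fun v : Fin 2 → ZMod p => v 0 ^ 2 - d * v 1 ^ 2 ∈ R with hX
  let Φ : (Fin 2 → ZMod p) → (Fin 2 → ZMod p) × (Fin 2 → ZMod p) := fun v =>
    (v, (v 0 ^ 2 - d * v 1 ^ 2)⁻¹ • ![v 0, -(d * v 1)])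
  have hΦ : Function.Injective Φ := fun v w h => congrArg Prod.fst h
  refine ⟨X.image Φ, card_image_of_injective _ hΦ, ?_⟩
  simp only [mem_image]
  rintro f ⟨v, hv, rfl⟩ f' ⟨v', hv', rfl⟩
  rw [hΦ.eq_iff]
  simp only [hX, mem_filter, mem_univ, true_and] at hv hv'
  obtain ⟨r, hr⟩ : ∃ r, v 0 ^ 2 - d * v 1 ^ 2 = r := ⟨_, rfl⟩
  obtain ⟨r', hr'⟩ : ∃ r', v' 0 ^ 2 - d * v' 1 ^ 2 = r' := ⟨_, rfl⟩
  rw [hr] at hv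
  rw [hr'] at hv'
  have hr0 : r ≠ 0 := fun h => hR0 (h ▸ hv)
  have hr'0 : r' ≠ 0 := fun h => hR0 (h ▸ hv')
  show v ⬝ᵥ ((v' 0 ^ 2 - d * v' 1 ^ 2)⁻¹ • ![v' 0, -(d * v' 1)]) = 1 ↔ v = v'
  rw [hr', dotProduct_tangentNormal, inv_mul_eq_one₀ hr'0]
  constructor
  · intro hB
    -- `B(v,v') = r'`; polar identity: `r'² - r r' = d (v₀ v'₁ - v'₀ v₁)²`
    have hpol := polar_sq_sub_norm_mul_norm d (v 0) (v 1) (v' 0) (v' 1)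
    rw [hr, hr', ← hB] at hpol
    have hrr : r' = r := by
      by_contra hne
      refine hR r' hv' r hv hne ⟨d * (v 0 * v' 1 - v' 0 * v 1), ?_⟩
      linear_combination d * hpol
    have hcross : d * (v 0 * v' 1 - v' 0 * v 1) ^ 2 = 0 := by
      rw [← hpol, hrr]
      ring
    have hc : v 0 * v' 1 - v' 0 * v 1 = 0 := by
      rcases mul_eq_zero.1 hcross with h | h
      · exact absurd h hd
      · exact (pow_eq_zero_iff two_ne_zero).1 h
    rw [hrr] at hB
    have hB' : v 0 * v' 0 - d * (v 1 * v' 1) = r := hB.symm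
    have h0 : v' 0 * r = v 0 * r := by
      linear_combination (-(v' 0)) * hr + (v 0) * hB' + (d * v 1) * hc
    have h1 : v' 1 * r = v 1 * r := by
      linear_combination (-(v' 1)) * hr + (v 1) * hB' + (v 0) * hc
    funext i
    fin_cases i
    · exact (mul_right_cancel₀ hr0 h0).symm
    · exact (mul_right_cancel₀ hr0 h1).symm
  · rintro rfl
    linear_combination hr'.symm

/-! ## Level curves of the norm form: existence of points and their number -/

/-- **Every level of a binary norm form is non-empty** (`p` odd, `d ≠ 0`): `x² − d y² = c` is
soluble for every `c`, by the pigeonhole count of Mathlib's `FiniteField.exists_root_sum_quadratic`.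
[folklore] -/
theorem exists_norm_eq (d : ZMod p) (hd : d ≠ 0) (hp2 : p ≠ 2) (c : ZMod p) :
    ∃ s t : ZMod p, s ^ 2 - d * t ^ 2 = c := by
  have hodd : Fintype.card (ZMod p) % 2 = 1 := by
    rw [ZMod.card]
    exact (Fact.out : p.Prime).eq_two_or_odd.resolve_left hp2
  let f : (ZMod p)[X] := X ^ 2
  let g : (ZMod p)[X] := C (-d) * X ^ 2 - C c
  have hf : degree f = 2 := degree_X_pow 2
  have hg0 : degree (C (-d) * X ^ 2 : (ZMod p)[X]) = 2 :=
    degree_C_mul_X_pow 2 (neg_ne_zero.2 hd)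
  have hg : degree g = 2 := by
    simp only [g]
    rw [degree_sub_C (by rw [hg0]; norm_num), hg0]
  obtain ⟨s, t, hst⟩ := FiniteField.exists_root_sum_quadratic hf hg hodd
  refine ⟨s, t, ?_⟩
  simp only [f, g, eval_pow, eval_X, eval_sub, eval_mul, eval_C] at hst
  linear_combination hst

/-- **Non-zero levels of a binary norm form are equinumerous** (`p` odd, `d ≠ 0`, `r, r' ≠ 0`):
multiplication by a vector of norm `r'/r` (`exists_norm_eq`) is an injective linear map carrying
the level `x² − d y² = r` into the level `r'` (`norm_mulMap`), so `|level r| ≤ |level r'|`, and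
symmetrically. [folklore] -/
theorem card_level_le_card_level (d : ZMod p) (hd : d ≠ 0) (hp2 : p ≠ 2) {r r' : ZMod p}
    (hr : r ≠ 0) (hr' : r' ≠ 0) :
    (univ.filter fun v : Fin 2 → ZMod p => v 0 ^ 2 - d * v 1 ^ 2 = r).card ≤
      (univ.filter fun v : Fin 2 → ZMod p => v 0 ^ 2 - d * v 1 ^ 2 = r').card := by
  classical
  obtain ⟨s, t, hst⟩ := exists_norm_eq d hd hp2 (r' * r⁻¹)
  have hq0 : s ^ 2 - d * t ^ 2 ≠ 0 := by
    rw [hst]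
    exact mul_ne_zero hr' (inv_ne_zero hr)
  let M : (Fin 2 → ZMod p) → (Fin 2 → ZMod p) := fun v =>
    ![s * v 0 + d * (t * v 1), s * v 1 + t * v 0]
  refine card_le_card_of_injOn M ?_ ?_
  · intro v hv
    simp only [coe_filter, mem_univ, true_and, Set.mem_setOf_eq] at hv ⊢
    simp only [M, Matrix.cons_val_zero, Matrix.cons_val_one, Matrix.cons_val_fin_one]
    rw [norm_mulMap, hst, hv, mul_assoc, inv_mul_cancel₀ hr, mul_one]
  · intro v _ w _ h
    have h0 : s * v 0 + d * (t * v 1) = s * w 0 + d * (t * w 1) := by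
      have := congrFun h 0
      simpa [M] using this
    have h1 : s * v 1 + t * v 0 = s * w 1 + t * w 0 := by
      have := congrFun h 1
      simpa [M] using this
    have e0 : (s ^ 2 - d * t ^ 2) * (v 0 - w 0) = 0 := by
      linear_combination s * h0 - (d * t) * h1
    have e1 : (s ^ 2 - d * t ^ 2) * (v 1 - w 1) = 0 := by
      linear_combination (-t) * h0 + s * h1
    have d0 : v 0 = w 0 := sub_eq_zero.1 ((mul_eq_zero.1 e0).resolve_left hq0)
    have d1 : v 1 = w 1 := sub_eq_zero.1 ((mul_eq_zero.1 e1).resolve_left hq0)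
    funext i
    fin_cases i
    · exact d0
    · exact d1

/-- **Non-zero levels of a binary norm form are equinumerous** (symmetric form of
`card_level_le_card_level`). [folklore] -/
theorem card_level_eq_card_level (d : ZMod p) (hd : d ≠ 0) (hp2 : p ≠ 2) {r r' : ZMod p}
    (hr : r ≠ 0) (hr' : r' ≠ 0) :
    (univ.filter fun v : Fin 2 → ZMod p => v 0 ^ 2 - d * v 1 ^ 2 = r).card =
      (univ.filter fun v : Fin 2 → ZMod p => v 0 ^ 2 - d * v 1 ^ 2 = r').card :=
  le_antisymm (card_level_le_card_level d hd hp2 hr hr') (card_level_le_card_level d hd hp2 hr' hr)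

/-- The levels of `x² − d y²` partition the plane: `Σ_c |level c| = p²`. [elementary] -/
theorem sum_card_level (d : ZMod p) :
    ∑ c : ZMod p, (univ.filter fun v : Fin 2 → ZMod p => v 0 ^ 2 - d * v 1 ^ 2 = c).card =
      p ^ 2 := by
  classical
  rw [← card_eq_sum_card_fiberwise fun v _ => mem_univ _, card_univ, Fintype.card_fun,
    Fintype.card_fin, ZMod.card]

/-- **The zero level is small**: `x² = d y²` (`d ≠ 0`) has at most `2p − 1` solutions — one with
`y = 0` and at most two for each `y ≠ 0`. [elementary] -/
theorem card_level_zero_le (d : ZMod p) :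
    (univ.filter fun v : Fin 2 → ZMod p => v 0 ^ 2 - d * v 1 ^ 2 = 0).card ≤ 2 * p - 1 := by
  classical
  set L0 := univ.filter fun v : Fin 2 → ZMod p => v 0 ^ 2 - d * v 1 ^ 2 = 0 with hL0
  have hfib : ∀ t : ZMod p, (L0.filter fun v => v 1 = t).card ≤
      (univ.filter fun x : ZMod p => x ^ 2 = d * t ^ 2).card := by
    intro t
    refine card_le_card_of_injOn (fun v => v 0) ?_ ?_
    · intro v hv
      simp only [hL0, coe_filter, mem_filter, mem_univ, true_and, Set.mem_setOf_eq] at hv ⊢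
      rw [← hv.2]
      exact sub_eq_zero.1 hv.1
    · intro v hv w hw h
      simp only [hL0, coe_filter, mem_filter, mem_univ, true_and, Set.mem_setOf_eq] at hv hw
      funext i
      fin_cases i
      · exact h
      · exact hv.2.trans hw.2.symm
  have hsum : L0.card = ∑ t : ZMod p, (L0.filter fun v => v 1 = t).card :=
    card_eq_sum_card_fiberwise fun v _ => mem_univ (v 1)
  have h0 : (L0.filter fun v => v 1 = 0).card ≤ 1 := by
    refine (hfib 0).trans ?_
    rw [card_le_one]
    intro x hx y hy
    simp only [mem_filter, mem_univ, true_and, ne_eq, OfNat.ofNat_ne_zero, not_false_eq_true,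
      zero_pow, mul_zero, pow_eq_zero_iff] at hx hy
    rw [hx, hy]
  -- `x² = c` has at most two solutions (both are `±` a fixed root)
  have hsq2 : ∀ c : ZMod p, (univ.filter fun x : ZMod p => x ^ 2 = c).card ≤ 2 := by
    intro c
    by_cases h : ∃ x₀ : ZMod p, x₀ ^ 2 = c
    · obtain ⟨x₀, rfl⟩ := h
      calc (univ.filter fun x : ZMod p => x ^ 2 = x₀ ^ 2).card
          ≤ ({x₀, -x₀} : Finset (ZMod p)).card := by
            refine card_le_card fun x hx => ?_
            simp only [mem_filter, mem_univ, true_and] at hx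
            rcases sq_eq_sq_iff_eq_or_eq_neg.1 hx with h1 | h1 <;> simp [h1]
        _ ≤ 2 := card_le_two
    · rw [filter_eq_empty_iff.2 fun x _ hx => h ⟨x, hx⟩, card_empty]
      exact Nat.zero_le _
  have ht : ∀ t ∈ (univ : Finset (ZMod p)).erase 0, (L0.filter fun v => v 1 = t).card ≤ 2 :=
    fun t _ => (hfib t).trans (hsq2 _)
  have hrest := Finset.sum_le_card_nsmul _ _ 2 ht
  rw [card_erase_of_mem (mem_univ _), card_univ, ZMod.card, smul_eq_mul] at hrest
  rw [hsum, ← Finset.add_sum_erase _ _ (mem_univ (0 : ZMod p))]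
  have hp1 : 1 ≤ p := (Fact.out : p.Prime).one_lt.le
  omega

/-- The zero level contains the origin: `1 ≤ |level 0|`. [elementary] -/
theorem one_le_card_level_zero (d : ZMod p) :
    1 ≤ (univ.filter fun v : Fin 2 → ZMod p => v 0 ^ 2 - d * v 1 ^ 2 = 0).card := by
  rw [Nat.one_le_iff_ne_zero, ← pos_iff_ne_zero, card_pos]
  exact ⟨0, by simp⟩

/-- **Every non-zero level of a binary norm form has between `p − 1` and `p + 1` points**
(`p` odd, `d ≠ 0`): with `N = |level r|` for `r ≠ 0`, the partition `Σ_c |level c| = p²` and the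
equinumerosity of non-zero levels give `(p−1)·N + |level 0| = p²`, and `1 ≤ |level 0| ≤ 2p − 1`.
(Exactly: `N = p + 1` circles for `d` a non-square, `N = p − 1` hyperbolas for `d` a square.)
[folklore] -/
theorem card_level_bounds (d : ZMod p) (hd : d ≠ 0) (hp2 : p ≠ 2) {r : ZMod p} (hr : r ≠ 0) :
    p - 1 ≤ (univ.filter fun v : Fin 2 → ZMod p => v 0 ^ 2 - d * v 1 ^ 2 = r).card ∧
      (univ.filter fun v : Fin 2 → ZMod p => v 0 ^ 2 - d * v 1 ^ 2 = r).card ≤ p + 1 := by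
  classical
  set N := (univ.filter fun v : Fin 2 → ZMod p => v 0 ^ 2 - d * v 1 ^ 2 = r).card with hN
  set L0 := (univ.filter fun v : Fin 2 → ZMod p => v 0 ^ 2 - d * v 1 ^ 2 = 0).card with hL0
  have hsum := sum_card_level (p := p) d
  rw [← Finset.add_sum_erase _ _ (mem_univ (0 : ZMod p))] at hsum
  have hconst : ∑ c ∈ (univ : Finset (ZMod p)).erase 0,
      (univ.filter fun v : Fin 2 → ZMod p => v 0 ^ 2 - d * v 1 ^ 2 = c).card =
      ∑ _c ∈ (univ : Finset (ZMod p)).erase 0, N := by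
    refine Finset.sum_congr rfl fun c hc => ?_
    exact card_level_eq_card_level d hd hp2 (ne_of_mem_erase hc) hr
  rw [hconst, sum_const, card_erase_of_mem (mem_univ _), card_univ, ZMod.card, smul_eq_mul]
    at hsum
  -- hsum : L0 + (p - 1) * N = p ^ 2
  have h1 := one_le_card_level_zero (p := p) d
  have h2 := card_level_zero_le (p := p) d
  rw [← hL0] at h1 h2 hsum
  have hp2' : 2 ≤ p := (Fact.out : p.Prime).two_le
  obtain ⟨m, rfl⟩ : ∃ m, p = m + 1 := ⟨p - 1, by omega⟩
  simp only [Nat.add_sub_cancel] at hsum h2 ⊢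
  have hm : 1 ≤ m := by omega
  have key : m * N + L0 = m * m + 2 * m + 1 := by linear_combination hsum
  constructor
  · have hle : m * m ≤ m * N := by
      have : L0 ≤ 2 * m + 1 := by omega
      linarith
    exact Nat.le_of_mul_le_mul_left hle (by omega)
  · have hle : m * N ≤ m * (m + 2) := by nlinarith
    have := Nat.le_of_mul_le_mul_left hle (by omega)
    omega

/-- **Size of a norm-form pencil.**  For `R ⊆ 𝔽_p ∖ {0}` (`p` odd, `d ≠ 0`) the point set
`X_R = {v : Q v ∈ R}` is the disjoint union of the levels `r ∈ R`, hence has between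
`|R|·(p − 1)` and `|R|·(p + 1)` points (`card_level_bounds`). [elementary] -/
theorem card_pencil_bounds (d : ZMod p) (hd : d ≠ 0) (hp2 : p ≠ 2) (R : Finset (ZMod p))
    (hR0 : (0 : ZMod p) ∉ R) :
    R.card * (p - 1) ≤ (univ.filter fun v : Fin 2 → ZMod p => v 0 ^ 2 - d * v 1 ^ 2 ∈ R).card ∧
      (univ.filter fun v : Fin 2 → ZMod p => v 0 ^ 2 - d * v 1 ^ 2 ∈ R).card ≤
        R.card * (p + 1) := by
  classical
  set X := univ.filter fun v : Fin 2 → ZMod p => v 0 ^ 2 - d * v 1 ^ 2 ∈ R with hX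
  have hdec : X.card = ∑ r ∈ R, (univ.filter fun v : Fin 2 → ZMod p =>
      v 0 ^ 2 - d * v 1 ^ 2 = r).card := by
    rw [card_eq_sum_card_fiberwise (f := fun v : Fin 2 → ZMod p => v 0 ^ 2 - d * v 1 ^ 2)
      (t := R) (fun v hv => by simpa [hX] using hv)]
    refine Finset.sum_congr rfl fun r hr => ?_
    congr 1
    ext v
    simp only [hX, filter_filter, mem_filter, mem_univ, true_and, and_iff_right_iff_imp]
    intro h
    rwa [h]
  have hr0 : ∀ r ∈ R, r ≠ 0 := fun r hr h => hR0 (h ▸ hr)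
  constructor
  · rw [hdec, mul_comm]
    calc (p - 1) * R.card = ∑ _r ∈ R, (p - 1) := by rw [sum_const, smul_eq_mul, mul_comm]
      _ ≤ _ := Finset.sum_le_sum fun r hr => (card_level_bounds d hd hp2 (hr0 r hr)).1
  · rw [hdec, mul_comm]
    calc _ ≤ ∑ _r ∈ R, (p + 1) :=
          Finset.sum_le_sum fun r hr => (card_level_bounds d hd hp2 (hr0 r hr)).2
      _ = (p + 1) * R.card := by rw [sum_const, smul_eq_mul, mul_comm]

/-! ## The stub from large norm-cliques -/

omit [Fact p.Prime] in
/-- **Reduction of `stub_tangencySets` to large norm-cliques** (the residual of the norm-pencil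
architecture, in the stub's exact quantifier shape).  Call `R ⊆ 𝔽_p ∖ {0}` a *norm-clique for
`d ≠ 0`* if `d·r(r − r')` is a non-square for all `r ≠ r'` in `R`.  If for some `c > 0` there are,
for unboundedly many primes `p`, norm-cliques of size `≥ c·√p`, then `stub_tangencySets` holds
with constant `c/2`: the pencil `{v : Q v ∈ R}` carries `≥ |R|·(p − 1) ≥ (c/2)·p^{3/2}` flags
(`normPencil_srs`, `card_pencil_bounds`), with NO loss at the origin.  For `p ≡ 1 (mod 4)` a
norm-clique is a Paley clique or coclique lying in one quadratic-residue class, so the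
hypothesis is the square-root barrier for Paley graphs once more (see the companion file
`…TangencyNormPencilRigidity`); for `p ≡ 3 (mod 4)` norm-cliques have at most two elements.
[elementary] -/
theorem stub_tangencySets_of_normCliques
    (h : ∃ c : ℝ, 0 < c ∧ ∀ p₀ : ℕ, ∃ (p : ℕ) (_ : Fact p.Prime), p₀ ≤ p ∧
      ∃ (d : ZMod p) (R : Finset (ZMod p)), d ≠ 0 ∧ (0 : ZMod p) ∉ R ∧
        (∀ r ∈ R, ∀ r' ∈ R, r ≠ r' → ¬ IsSquare (d * (r * (r - r')))) ∧
        c * Real.sqrt p ≤ R.card) :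
    ∃ c : ℝ, 0 < c ∧ ∀ p₀ : ℕ, ∃ (p : ℕ) (_ : Fact p.Prime), p₀ ≤ p ∧
      ∃ S : Finset ((Fin 2 → ZMod p) × (Fin 2 → ZMod p)),
        c * (p : ℝ) ^ (3 / 2 : ℝ) ≤ S.card ∧
        ∀ f ∈ S, ∀ f' ∈ S, (dotProduct f.1 f'.2 = 1 ↔ f = f') := by
  obtain ⟨c, hc, hfam⟩ := h
  refine ⟨c / 2, by positivity, fun p₀ => ?_⟩
  obtain ⟨p, hp, hp₀, d, R, hd, hR0, hR, hcard⟩ := hfam (max p₀ 3)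
  have hp3 : 3 ≤ p := le_trans (le_max_right _ _) hp₀
  have hp2 : p ≠ 2 := by omega
  obtain ⟨S, hS, hsrs⟩ := normPencil_srs d hd R hR0 hR
  refine ⟨p, hp, le_trans (le_max_left _ _) hp₀, S, ?_, hsrs⟩
  have hX := (card_pencil_bounds d hd hp2 R hR0).1
  rw [← hS] at hX
  have hX' : (R.card : ℝ) * ((p : ℝ) - 1) ≤ S.card := by
    have h1 : (1 : ℕ) ≤ p := by omega
    have := hX
    rw [← Nat.cast_le (α := ℝ), Nat.cast_mul, Nat.cast_sub h1, Nat.cast_one] at this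
    exact this
  have h32 : (p : ℝ) ^ (3 / 2 : ℝ) = p * Real.sqrt p := by
    rw [show (3 / 2 : ℝ) = 1 + 1 / 2 by norm_num,
      Real.rpow_add (by exact_mod_cast (show 0 < p by omega)), Real.rpow_one, Real.sqrt_eq_rpow]
  rw [h32]
  have hp' : (3 : ℝ) ≤ p := by exact_mod_cast hp3
  have hcs : 0 ≤ c * Real.sqrt p := by positivity
  calc c / 2 * ((p : ℝ) * Real.sqrt p) = (c * Real.sqrt p) * (p / 2) := by ring
    _ ≤ (c * Real.sqrt p) * ((p : ℝ) - 1) := by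
        apply mul_le_mul_of_nonneg_left _ hcs
        linarith
    _ ≤ (R.card : ℝ) * ((p : ℝ) - 1) := by
        apply mul_le_mul_of_nonneg_right hcard
        linarith
    _ ≤ S.card := hX'

end Summit.MatrixMultiplication.MatrixMultiplication.Theorems.LevelOneGL2Designs.NormPencil
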